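/-
Copyright (c) 2026 the pub-hodgecm-mathlib formalisation cell (harness21).  Prover seat hodgecm-mathlib-K2Liu-p08 (g0), Track B «K2-LIT»,
#184♮ = hLiu418 = `stmt-HodgeConjecture-24832`; K2E5-plan (g5) CO-DEAL 2026-09-04T06:07:47Z (M-156c co-dealer rule, LEAD F0P6-plan (g12))
ROAD I v3 brick U0 «the normalised residue form»; inputs ★ socket-#41-shaped continuation data, ★ `K2LiuEisensteinResidueOfGenerators` (O42.7),
★ `K2LiuContinuationsAgree` (#47a), the DEFS leaf `K2LiuFirstTermResidueFormDefs` (`resNorm`).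
-/
import Summits.HodgeConjecture.HodgeConjecture.Theorems.K2LiuFirstTermResidueFormDefs        -- `resNorm` (DEFS leaf of this brick)
import Summits.HodgeConjecture.HodgeConjecture.Theorems.K2LiuEisensteinResidueOfGenerators   -- ★ O42.7: `tendsto_residue_finset_sum`, `differentiableOn_div_prod`, …
import HarnessLib

/-!
# Crux `HLiu418`, Road I v3 (#42F′ by uniqueness), brick U0: the NORMALISED RESIDUE FORM `h ↦ Res_{s=½} E(s, h)` of a pole-cleared
# continuation — it is the `(s − ½)`-limit, it does not depend on the continuation, it is a continuous automorphic function of moderate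
# growth, and it is linear in the section family

Cell `hodgecm-mathlib`, crux item hLiu418 = `stmt-HodgeConjecture-24832`; road-map owner ∕ co-dealer K2E5-plan (g5) (CO-DEAL 06:07:47Z; binder sheet
`K2/K2E5-plan/g5/SIGS-RoadI-v3.md` §U0), LEAD F0P6-plan (g12), boxes K2E5-r01 (g6) ∕ K2Liu-ref1 (g2).  THEOREMS ONLY (no `def` — the one definition
`resNorm` is the DEFS leaf —, no instance, no notation, no named-fact hypothesis, no `sorry`); lane `--supports stmt-HodgeConjecture-24832 --as helper`
(count-neutral).  Consumers: every U-organ of Road I v3 (U1, U3 `K2LiuResidueMapEquivariant`, U5 and the #42F′ closer), which discharge #42F′'s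
ARBITRARY `(Pg, Eg)` binders from ONE canonical continuation through (U0.2).

THE DATA (socket #41 `sig_K2LiuSiegelEisensteinContinuation`, U6 ED. 10 :267, conjuncts (i)–(v), over the frame `L e dV hdV dW hdW`, any `N M n`):
a finite `P ⊂ ℂ` and `E⋆ : ℂ → H(𝔸) → ℂ` with (i) `s ↦ E⋆(s, h)` holomorphic on `{Re s > 0}`; (ii) `E⋆(s, ·)` continuous; (iii) left-`H(L⁺)`-invariant
(★ `ratH`); (iv) `E⋆(s, h) = ∏_{p∈P}(s − p) · E^Δ(h; f_s)` on `{Re s > n/2}` (★ `eisensteinFamilyDelta`); (v) locally uniform moderate growth in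
★ `adelicHeightGL`.  `resNorm P E⋆ h = E⋆(½, h)/∏_{p∈P∖½}(½ − p)` (`½ ∈ P`), `0` (`½ ∉ P`).

* §1 (U0.1) `tendsto_resNorm`: from (i) alone (indeed from continuity of `E⋆(·, h)` at `½`), `(s − ½)·(E⋆(s, h)/∏_P(s − p)) → resNorm P E⋆ h` along
  `𝓝[≠] ½` (simple roots: `∏_P = (s − ½)·∏_{P∖½}`; the `½ ∉ P` branch tends to `0·(…) = 0`).
* §2 (U0.2) `resNorm_eq_of_continuations`: two pairs `(P, E⋆)`, `(P′, E′)` satisfying (i) and (iv) for the SAME family `f` have the same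
  `resNorm` — the quotients `E⋆/∏_P`, `E′/∏_{P′}` are holomorphic on the convex `{Re s > 0}` minus the finite `P ∪ P′` and BOTH equal `E^Δ(·; f_s)` far to
  the right, so they agree there (★ #47a `continuationsAgree`), hence their `(s − ½)`-limits agree (uniqueness of limits along the non-trivial filter
  `𝓝[≠] ½`).  NO section hypothesis on `f` is needed.
* §3 (U0.3) `continuous_resNorm` (from (ii)), `resNorm_ratH_mul` (from (iii)), `exists_norm_resNorm_le` (from (v) at `z = ½`).
* §4 (U0.4) linearity in `f` (★ O42.7 `tendsto_residue_finset_sum`: the Eisenstein series is additive on `{Re s > n/2}` by absolute convergence ★ #9,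
  so section hypotheses `IsSiegelDeltaSection` + continuity + `χ` unitary + `dV i, dW j ≠ 0` enter HERE only): `resNorm_finset_sum`
  (`f = Σ_j c_j g_j ⇒ resNorm P E⋆ = Σ_j c_j · resNorm (Pg j) (Eg j)` for ANY admissible continuations), `resNorm_smul`, `resNorm_add`.

[KudlaRallis1994, §1 Thm. 1.1] [Liu2021, App. B Lem. B.10 (2), B.12 pp. 102–104] [Tan1999, §1] [MoeglinWaldspurger1995, IV.1.9–IV.1.11].
HONEST LABEL.  Count-neutral helper; U0 closes no socket by itself; `HC_CM` is proved only modulo the 7 printed citations (2 remaining named inputs: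
hLiu418 = `stmt-HodgeConjecture-24832`, h413 = `stmt-HodgeConjecture-24833`) until rung 0 closes.
-/

set_option autoImplicit false
set_option linter.dupNamespace false -- the mandated namespace repeats `HodgeConjecture.HodgeConjecture`
-- statements over the adelic doubled carriers elaborate to very large types; elaborate sequentially (as ★ `K2LiuEisensteinResidueOfGenerators`)
set_option Elab.async false

noncomputable section

open NumberField IsDedekindDomain Filter
open scoped Topology BigOperators

namespace Summit.HodgeConjecture.HodgeConjecture.Cruxes.HLiu418.K2LiuFirstTermResidueForm

open Literature.NumberTheory.Automorphic
open Literature.NumberTheory.GaloisRepresentations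
open Literature.NumberTheory.GelbartRogawski1991 Literature.NumberTheory.GelbartRogawski1991.GRConstruction
open Literature.NumberTheory.K2Lit.SiegelDoubled
open Summit.HodgeConjecture.HodgeConjecture.Cruxes.HLiu418.K2LiuFirstTermResidueFormDefs
open Summit.HodgeConjecture.HodgeConjecture.Cruxes.HLiu418.K2LiuEisensteinResidueOfGenerators
  (tendsto_residue_finset_sum differentiableOn_div_prod prod_sub_ne_zero not_mem_of_sum_norm_lt_re)
open Summit.HodgeConjecture.HodgeConjecture.Cruxes.HLiu418.K2LiuContinuationsAgree (continuationsAgree)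

/-! ## §1 (U0.1) the normalised residue is the `(s − ½)`-limit -/

/-- `Re ½ > 0`: the top pole lies in the domain of holomorphy `{Re s > 0}`. [folklore] -/
theorem re_half_pos : (0 : ℝ) < (1 / 2 : ℂ).re := by
  have h : (1 / 2 : ℂ) = ((1 / 2 : ℝ) : ℂ) := by push_cast; ring
  rw [h, Complex.ofReal_re]
  norm_num

/-- clause (i) ⇒ `s ↦ E⋆(s, h)` is continuous at `½`. [folklore] -/
theorem continuousAt_half_of_differentiableOn {X : Type*} {Es : ℂ → X → ℂ}
    (hd : ∀ h, DifferentiableOn ℂ (fun s => Es s h) {s : ℂ | 0 < s.re}) (h : X) :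
    ContinuousAt (fun s => Es s h) (1 / 2) :=
  ((hd h).differentiableAt ((isOpen_lt continuous_const Complex.continuous_re).mem_nhds re_half_pos)).continuousAt

/-- **(U0.1′) `(s − ½) · (E⋆(s, h) / ∏_{p∈P}(s − p)) → resNorm P E⋆ h` along `𝓝[≠] ½`**, for any `E⋆` with `s ↦ E⋆(s, h)` continuous at `½` (the roots
of the clearing polynomial are simple; off `½` the factor `(s − ½)` cancels if `½ ∈ P`, and tends to `0` otherwise). [cite: KudlaRallis1994, §1 Thm. 1.1]
[cite: Tan1999, §1] -/
theorem tendsto_resNorm_of_continuousAt {X : Type*} (P : Finset ℂ) (Es : ℂ → X → ℂ) (h : X)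
    (hcont : ContinuousAt (fun s => Es s h) (1 / 2)) :
    Tendsto (fun s : ℂ => (s - 1 / 2) * (Es s h / ∏ p ∈ P, (s - p))) (𝓝[≠] (1 / 2)) (𝓝 (resNorm P Es h)) := by
  have hQc : ∀ Q : Finset ℂ, Continuous fun s : ℂ => ∏ p ∈ Q, (s - p) := fun Q =>
    continuous_finsetProd Q fun p _ => continuous_id.sub continuous_const
  by_cases hP : (1 / 2 : ℂ) ∈ P
  · rw [resNorm_of_mem hP]
    have hlim : Tendsto (fun s : ℂ => Es s h / ∏ p ∈ P.erase (1 / 2), (s - p)) (𝓝[≠] (1 / 2))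
        (𝓝 (Es (1 / 2) h / ∏ p ∈ P.erase (1 / 2), ((1 / 2 : ℂ) - p))) :=
      (hcont.div (hQc _).continuousAt (prod_erase_half_sub_ne_zero P)).tendsto.mono_left nhdsWithin_le_nhds
    refine hlim.congr' ?_
    filter_upwards [self_mem_nhdsWithin] with s hs
    rw [← Finset.mul_prod_erase P (fun p => s - p) hP, ← mul_div_assoc, mul_div_mul_left _ _ (sub_ne_zero.2 hs)]
  · rw [resNorm_of_not_mem hP]
    have hP0 : ∏ p ∈ P, ((1 / 2 : ℂ) - p) ≠ 0 := prod_sub_ne_zero P hP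
    have hlim : Tendsto (fun s : ℂ => (s - 1 / 2) * (Es s h / ∏ p ∈ P, (s - p))) (𝓝 (1 / 2))
        (𝓝 (((1 / 2 : ℂ) - 1 / 2) * (Es (1 / 2) h / ∏ p ∈ P, ((1 / 2 : ℂ) - p)))) :=
      ((continuous_id.sub continuous_const).continuousAt.mul (hcont.div (hQc P).continuousAt hP0)).tendsto
    rw [sub_self, zero_mul] at hlim
    exact hlim.mono_left nhdsWithin_le_nhds

/-- **(U0.1) the normalised residue is the `𝓝[≠] ½`-limit of `(s − ½) · E⋆(s, h)/∏_P(s − p)`** under socket #41's clause (i) (holomorphy of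
`s ↦ E⋆(s, h)` on `{Re s > 0}`). [cite: KudlaRallis1994, §1 Thm. 1.1] [cite: Liu2021, Lem. B.12 pp. 103–104] [cite: Tan1999, §1] -/
theorem tendsto_resNorm {X : Type*} (P : Finset ℂ) (Es : ℂ → X → ℂ)
    (hd : ∀ h, DifferentiableOn ℂ (fun s => Es s h) {s : ℂ | 0 < s.re}) (h : X) :
    Tendsto (fun s : ℂ => (s - 1 / 2) * (Es s h / ∏ p ∈ P, (s - p))) (𝓝[≠] (1 / 2)) (𝓝 (resNorm P Es h)) :=
  tendsto_resNorm_of_continuousAt P Es h (continuousAt_half_of_differentiableOn hd h)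

/-! ## §2 (U0.2) independence of the continuation -/

section Frame

variable (L : Type) [Field L] [NumberField L] [IsCMField L]
variable {N M n : ℕ} (e : Fin N × Fin M ≃ Fin n)
  (dV : Fin N → L) (hdV : ∀ i, IsCMField.complexConj L (dV i) = dV i) (hdV0 : ∀ i, dV i ≠ 0)
  (dW : Fin M → L) (hdW : ∀ i, IsCMField.complexConj L (dW i) = dW i) (hdW0 : ∀ i, dW i ≠ 0)

/-- **(U0.2) THE NORMALISED RESIDUE DOES NOT DEPEND ON THE CONTINUATION.**  If `(P, E⋆)` and `(P′, E′)` both satisfy socket #41's clauses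
(i) (holomorphy on `{Re s > 0}`) and (iv) (agreement with `∏(s − p)·E^Δ(·; f_s)` on `{Re s > n/2}`) for the SAME family `f`, then
`resNorm P E⋆ = resNorm P′ E′`: the quotients `E⋆/∏_P` and `E′/∏_{P′}` are holomorphic on the convex `{Re s > 0}` minus the finite `P ∪ P′` and both
equal `E^Δ(·; f_s)` on the half-plane `Re s > n/2 + Σ‖p‖` (★ #47a `continuationsAgree`), and limits along `𝓝[≠] ½` are unique.  No hypothesis on `f`.
[cite: Liu2021, Lem. B.12 pp. 103–104] [cite: MoeglinWaldspurger1995, IV.1.9] [cite: KudlaRallis1994, §1 Thm. 1.1] -/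
theorem resNorm_eq_of_continuations (f : ℂ → HA L e dV hdV dW hdW → ℂ)
    (P : Finset ℂ) (Es : ℂ → HA L e dV hdV dW hdW → ℂ)
    (hd : ∀ h : HA L e dV hdV dW hdW, DifferentiableOn ℂ (fun s => Es s h) {s : ℂ | 0 < s.re})
    (hiv : ∀ (s : ℂ) (h : HA L e dV hdV dW hdW), (n : ℝ) / 2 < s.re →
      Es s h = (∏ p ∈ P, (s - p)) * eisensteinFamilyDelta L e dV hdV dW hdW f s h)
    (P' : Finset ℂ) (E' : ℂ → HA L e dV hdV dW hdW → ℂ)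
    (hd' : ∀ h : HA L e dV hdV dW hdW, DifferentiableOn ℂ (fun s => E' s h) {s : ℂ | 0 < s.re})
    (hiv' : ∀ (s : ℂ) (h : HA L e dV hdV dW hdW), (n : ℝ) / 2 < s.re →
      E' s h = (∏ p ∈ P', (s - p)) * eisensteinFamilyDelta L e dV hdV dW hdW f s h) :
    resNorm P Es = resNorm P' E' := by
  funext h
  -- the two quotients agree off `B := P ∪ P′` on `{Re s > 0}`
  set B : Set ℂ := (↑P : Set ℂ) ∪ (↑P' : Set ℂ) with hB
  have hBfin : B.Finite := P.finite_toSet.union P'.finite_toSet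
  set s₁ : ℝ := (n : ℝ) / 2 + (∑ p ∈ P, ‖p‖ + ∑ p ∈ P', ‖p‖) with hs₁
  have hU : IsOpen {w : ℂ | 0 < w.re} := isOpen_lt continuous_const Complex.continuous_re
  have hUc : Convex ℝ {w : ℂ | 0 < w.re} := convex_halfSpace_re_gt 0
  have hP0 : 0 ≤ ∑ p ∈ P, ‖p‖ := Finset.sum_nonneg fun p _ => norm_nonneg p
  have hP0' : 0 ≤ ∑ p ∈ P', ‖p‖ := Finset.sum_nonneg fun p _ => norm_nonneg p
  have hn0 : (0 : ℝ) ≤ (n : ℝ) / 2 := by positivity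
  have hsub : {w : ℂ | s₁ < w.re} ⊆ {w : ℂ | 0 < w.re} := fun w hw => by
    have hw' : s₁ < w.re := hw
    show 0 < w.re
    linarith
  have hZ₁ : DifferentiableOn ℂ (fun w => Es w h / ∏ p ∈ P, (w - p)) ({w : ℂ | 0 < w.re} \ B) :=
    differentiableOn_div_prod (hd h) P Set.subset_union_left
  have hZ₂ : DifferentiableOn ℂ (fun w => E' w h / ∏ p ∈ P', (w - p)) ({w : ℂ | 0 < w.re} \ B) :=
    differentiableOn_div_prod (hd' h) P' Set.subset_union_right
  have hagree : ∀ w : ℂ, s₁ < w.re → Es w h / ∏ p ∈ P, (w - p) = E' w h / ∏ p ∈ P', (w - p) := by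
    intro w hw
    have hw' : (n : ℝ) / 2 < w.re := by linarith
    have hwP : w ∉ P := not_mem_of_sum_norm_lt_re P (by linarith)
    have hwP' : w ∉ P' := not_mem_of_sum_norm_lt_re P' (by linarith)
    rw [hiv w h hw', hiv' w h hw', mul_div_cancel_left₀ _ (prod_sub_ne_zero P hwP),
      mul_div_cancel_left₀ _ (prod_sub_ne_zero P' hwP')]
  have key := continuationsAgree {w : ℂ | 0 < w.re} {w : ℂ | 0 < w.re} B hBfin hU hUc hU hUc s₁ hsub hsub _ _ hZ₁ hZ₂ hagree
  -- hence the `(s − ½)`-quotients agree on a punctured neighbourhood of `½`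
  have hopen : IsOpen ({w : ℂ | 0 < w.re} \ (B \ {(1 / 2 : ℂ)})) := hU.sdiff hBfin.sdiff.isClosed
  have hmem : (1 / 2 : ℂ) ∈ {w : ℂ | 0 < w.re} \ (B \ {(1 / 2 : ℂ)}) := ⟨re_half_pos, fun h' => h'.2 rfl⟩
  have hev : (fun s : ℂ => (s - 1 / 2) * (E' s h / ∏ p ∈ P', (s - p))) =ᶠ[𝓝[≠] (1 / 2)]
      fun s : ℂ => (s - 1 / 2) * (Es s h / ∏ p ∈ P, (s - p)) := by
    filter_upwards [mem_nhdsWithin_of_mem_nhds (hopen.mem_nhds hmem), self_mem_nhdsWithin] with s hs hne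
    have hsB : s ∉ B := fun hb => hs.2 ⟨hb, hne⟩
    have hk : Es s h / ∏ p ∈ P, (s - p) = E' s h / ∏ p ∈ P', (s - p) := key ⟨⟨hs.1, hs.1⟩, hsB⟩
    rw [hk]
  exact tendsto_nhds_unique (tendsto_resNorm P Es hd h) ((tendsto_resNorm P' E' hd' h).congr' hev)

/-! ## §3 (U0.3) continuity, automorphy, moderate growth -/

/-- **(U0.3a) the normalised residue form is continuous** (clause (ii) at `s = ½`). [cite: MoeglinWaldspurger1995, IV.1.9–IV.1.11] -/
theorem continuous_resNorm (P : Finset ℂ) (Es : ℂ → HA L e dV hdV dW hdW → ℂ)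
    (hii : ∀ s : ℂ, 0 < s.re → Continuous (Es s)) : Continuous (resNorm P Es) := by
  by_cases hP : (1 / 2 : ℂ) ∈ P
  · rw [resNorm_eq_const_mul_of_mem hP]
    exact continuous_const.mul (hii _ re_half_pos)
  · rw [resNorm_eq_zero_of_not_mem hP]
    exact continuous_const

/-- **(U0.3b) the normalised residue form is left-`H(L⁺)`-invariant** (clause (iii) at `s = ½`). [cite: MoeglinWaldspurger1995, IV.1.9–IV.1.11] -/
theorem resNorm_ratH_mul (P : Finset ℂ) (Es : ℂ → HA L e dV hdV dW hdW → ℂ)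
    (hiii : ∀ s : ℂ, 0 < s.re → ∀ (γ : ratH L e dV hdV dW hdW) (h : HA L e dV hdV dW hdW),
      Es s ((γ : HA L e dV hdV dW hdW) * h) = Es s h)
    (γ : ratH L e dV hdV dW hdW) (h : HA L e dV hdV dW hdW) :
    resNorm P Es ((γ : HA L e dV hdV dW hdW) * h) = resNorm P Es h := by
  by_cases hP : (1 / 2 : ℂ) ∈ P
  · rw [resNorm_of_mem hP, resNorm_of_mem hP, hiii _ re_half_pos γ h]
  · rw [resNorm_of_not_mem hP, resNorm_of_not_mem hP]

/-- **(U0.3c) the normalised residue form is of moderate growth** (clause (v) at `z = ½`): `‖resNorm P E⋆ h‖ ≤ C′ · ‖h‖^A`.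
[cite: MoeglinWaldspurger1995, IV.1.9–IV.1.11] [cite: Liu2021, Lem. B.12 pp. 103–104] -/
theorem exists_norm_resNorm_le (P : Finset ℂ) (Es : ℂ → HA L e dV hdV dW hdW → ℂ)
    (hv : ∀ z : ℂ, 0 < z.re → ∃ C A r : ℝ, 0 < r ∧ ∀ s : ℂ, dist s z < r → ∀ h : HA L e dV hdV dW hdW,
      ‖Es s h‖ ≤ C * adelicHeightGL (n + n) L (h : GL (Fin (n + n)) (AdeleRing (𝓞 L) L)) ^ A) :
    ∃ C A : ℝ, ∀ h : HA L e dV hdV dW hdW,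
      ‖resNorm P Es h‖ ≤ C * adelicHeightGL (n + n) L (h : GL (Fin (n + n)) (AdeleRing (𝓞 L) L)) ^ A := by
  obtain ⟨C, A, r, hr, hb⟩ := hv (1 / 2) re_half_pos
  have h12 : dist (1 / 2 : ℂ) (1 / 2) < r := by rwa [dist_self]
  by_cases hP : (1 / 2 : ℂ) ∈ P
  · refine ⟨C / ‖∏ p ∈ P.erase (1 / 2), ((1 / 2 : ℂ) - p)‖, A, fun h => ?_⟩
    rw [resNorm_of_mem hP, norm_div, div_mul_eq_mul_div]
    exact div_le_div_of_nonneg_right (hb _ h12 h) (norm_nonneg _)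
  · refine ⟨C, A, fun h => ?_⟩
    rw [resNorm_of_not_mem hP, norm_zero]
    exact (norm_nonneg _).trans (hb _ h12 h)

/-! ## §4 (U0.4) linearity in the section family -/

include hdV0 hdW0 in
/-- **(U0.4) LINEARITY: the normalised residue form of a finite combination is the combination of the residue forms**, for ANY admissible
continuations.  `χ` unitary; `g_j` continuous section families in `I(·, χ)` (★ `IsSiegelDeltaSection`), `f = Σ_j c_j g_j`; `(P, E⋆)` resp.
`(Pg j, Eg j)` satisfying socket #41's clauses (i), (iv) for `f` resp. `g_j`.  Then `resNorm P E⋆ = Σ_j c_j · resNorm (Pg j) (Eg j)` (★ O42.7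
`tendsto_residue_finset_sum` + (U0.1) + uniqueness of the limit). [cite: KudlaRallis1994, §1 Thm. 1.1] [cite: Liu2021, Lem. B.12 pp. 103–104] -/
theorem resNorm_finset_sum (χ : HeckeCharacter L) (hχ : χ.IsUnitary) {m : ℕ} (c : Fin m → ℂ)
    (g : Fin m → ℂ → HA L e dV hdV dW hdW → ℂ)
    (hg : ∀ j s, IsSiegelDeltaSection L e dV hdV dW hdW χ s (g j s)) (hgc : ∀ j s, Continuous (g j s))
    (f : ℂ → HA L e dV hdV dW hdW → ℂ) (hf : f = ∑ j, c j • g j)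
    (P : Finset ℂ) (Es : ℂ → HA L e dV hdV dW hdW → ℂ)
    (hhol : ∀ h : HA L e dV hdV dW hdW, DifferentiableOn ℂ (fun s => Es s h) {s : ℂ | 0 < s.re})
    (heq : ∀ (s : ℂ) (h : HA L e dV hdV dW hdW), (n : ℝ) / 2 < s.re →
      Es s h = (∏ p ∈ P, (s - p)) * eisensteinFamilyDelta L e dV hdV dW hdW f s h)
    (Pg : Fin m → Finset ℂ) (Eg : Fin m → ℂ → HA L e dV hdV dW hdW → ℂ)
    (hholg : ∀ (j : Fin m) (h : HA L e dV hdV dW hdW), DifferentiableOn ℂ (fun s => Eg j s h) {s : ℂ | 0 < s.re})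
    (heqg : ∀ (j : Fin m) (s : ℂ) (h : HA L e dV hdV dW hdW), (n : ℝ) / 2 < s.re →
      Eg j s h = (∏ p ∈ Pg j, (s - p)) * eisensteinFamilyDelta L e dV hdV dW hdW (g j) s h) :
    resNorm P Es = fun h => ∑ j, c j * resNorm (Pg j) (Eg j) h := by
  funext h
  exact tendsto_nhds_unique (tendsto_resNorm P Es hhol h)
    (tendsto_residue_finset_sum L e dV hdV hdV0 dW hdW hdW0 χ hχ c g hg hgc f hf P Es hhol heq Pg Eg hholg heqg h re_half_pos
      (fun j => resNorm (Pg j) (Eg j) h) (fun j => tendsto_resNorm (Pg j) (Eg j) (hholg j) h))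

include hdV0 hdW0 in
/-- **(U0.4, scalar) `resNorm` of `c • g` is `c ·` `resNorm` of `g`** (any admissible continuations). [cite: KudlaRallis1994, §1 Thm. 1.1] -/
theorem resNorm_smul (χ : HeckeCharacter L) (hχ : χ.IsUnitary) (c : ℂ) (g : ℂ → HA L e dV hdV dW hdW → ℂ)
    (hg : ∀ s, IsSiegelDeltaSection L e dV hdV dW hdW χ s (g s)) (hgc : ∀ s, Continuous (g s))
    (f : ℂ → HA L e dV hdV dW hdW → ℂ) (hf : f = c • g)
    (P : Finset ℂ) (Es : ℂ → HA L e dV hdV dW hdW → ℂ)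
    (hhol : ∀ h : HA L e dV hdV dW hdW, DifferentiableOn ℂ (fun s => Es s h) {s : ℂ | 0 < s.re})
    (heq : ∀ (s : ℂ) (h : HA L e dV hdV dW hdW), (n : ℝ) / 2 < s.re →
      Es s h = (∏ p ∈ P, (s - p)) * eisensteinFamilyDelta L e dV hdV dW hdW f s h)
    (Pg : Finset ℂ) (Eg : ℂ → HA L e dV hdV dW hdW → ℂ)
    (hholg : ∀ h : HA L e dV hdV dW hdW, DifferentiableOn ℂ (fun s => Eg s h) {s : ℂ | 0 < s.re})
    (heqg : ∀ (s : ℂ) (h : HA L e dV hdV dW hdW), (n : ℝ) / 2 < s.re →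
      Eg s h = (∏ p ∈ Pg, (s - p)) * eisensteinFamilyDelta L e dV hdV dW hdW g s h) :
    resNorm P Es = fun h => c * resNorm Pg Eg h := by
  have hf' : f = ∑ j : Fin 1, (fun _ : Fin 1 => c) j • (fun _ : Fin 1 => g) j := by
    rw [Fin.sum_univ_one]
    exact hf
  have key := resNorm_finset_sum L e dV hdV hdV0 dW hdW hdW0 χ hχ (fun _ : Fin 1 => c) (fun _ : Fin 1 => g)
    (fun _ s => hg s) (fun _ s => hgc s) f hf' P Es hhol heq (fun _ => Pg) (fun _ => Eg) (fun _ h => hholg h) (fun _ s h => heqg s h)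
  rw [key]
  funext h
  rw [Fin.sum_univ_one]

include hdV0 hdW0 in
/-- **(U0.4, additive) `resNorm` of `g₁ + g₂` is the sum of the `resNorm`s** (any admissible continuations). [cite: KudlaRallis1994, §1 Thm. 1.1] -/
theorem resNorm_add (χ : HeckeCharacter L) (hχ : χ.IsUnitary) (g₁ g₂ : ℂ → HA L e dV hdV dW hdW → ℂ)
    (hg₁ : ∀ s, IsSiegelDeltaSection L e dV hdV dW hdW χ s (g₁ s)) (hgc₁ : ∀ s, Continuous (g₁ s))
    (hg₂ : ∀ s, IsSiegelDeltaSection L e dV hdV dW hdW χ s (g₂ s)) (hgc₂ : ∀ s, Continuous (g₂ s))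
    (f : ℂ → HA L e dV hdV dW hdW → ℂ) (hf : f = g₁ + g₂)
    (P : Finset ℂ) (Es : ℂ → HA L e dV hdV dW hdW → ℂ)
    (hhol : ∀ h : HA L e dV hdV dW hdW, DifferentiableOn ℂ (fun s => Es s h) {s : ℂ | 0 < s.re})
    (heq : ∀ (s : ℂ) (h : HA L e dV hdV dW hdW), (n : ℝ) / 2 < s.re →
      Es s h = (∏ p ∈ P, (s - p)) * eisensteinFamilyDelta L e dV hdV dW hdW f s h)
    (P₁ : Finset ℂ) (E₁ : ℂ → HA L e dV hdV dW hdW → ℂ)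
    (hhol₁ : ∀ h : HA L e dV hdV dW hdW, DifferentiableOn ℂ (fun s => E₁ s h) {s : ℂ | 0 < s.re})
    (heq₁ : ∀ (s : ℂ) (h : HA L e dV hdV dW hdW), (n : ℝ) / 2 < s.re →
      E₁ s h = (∏ p ∈ P₁, (s - p)) * eisensteinFamilyDelta L e dV hdV dW hdW g₁ s h)
    (P₂ : Finset ℂ) (E₂ : ℂ → HA L e dV hdV dW hdW → ℂ)
    (hhol₂ : ∀ h : HA L e dV hdV dW hdW, DifferentiableOn ℂ (fun s => E₂ s h) {s : ℂ | 0 < s.re})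
    (heq₂ : ∀ (s : ℂ) (h : HA L e dV hdV dW hdW), (n : ℝ) / 2 < s.re →
      E₂ s h = (∏ p ∈ P₂, (s - p)) * eisensteinFamilyDelta L e dV hdV dW hdW g₂ s h) :
    resNorm P Es = fun h => resNorm P₁ E₁ h + resNorm P₂ E₂ h := by
  have hf' : f = ∑ j : Fin 2, (fun _ : Fin 2 => (1 : ℂ)) j • (![g₁, g₂]) j := by
    rw [Fin.sum_univ_two, hf]
    simp only [one_smul, Matrix.cons_val_zero, Matrix.cons_val_one]
  have key := resNorm_finset_sum L e dV hdV hdV0 dW hdW hdW0 χ hχ (fun _ : Fin 2 => (1 : ℂ)) ![g₁, g₂]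
    (fun j s => by fin_cases j <;> simp [hg₁ s, hg₂ s]) (fun j s => by fin_cases j <;> simp [hgc₁ s, hgc₂ s]) f hf' P Es hhol heq
    ![P₁, P₂] ![E₁, E₂] (fun j h => by fin_cases j <;> simp [hhol₁ h, hhol₂ h])
    (fun j s h hs => by fin_cases j <;> simp [heq₁ s h hs, heq₂ s h hs])
  rw [key]
  funext h
  rw [Fin.sum_univ_two]
  simp only [one_mul, Matrix.cons_val_zero, Matrix.cons_val_one]

end Frame

end Summit.HodgeConjecture.HodgeConjecture.Cruxes.HLiu418.K2LiuFirstTermResidueForm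

end
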